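import Literature.MathematicalPhysics.QuantumFieldTheory.Balaban1983to89.Node00.LinearisedAveragingAtBackground

/-!
# NODE 00 — THE LINEARISED AVERAGING AT THE FLAT BACKGROUND `U₀ = 1`: `Q_1(1) = linAvg` and `Q_k(1)` = the `linAvg` recursion on skew-Hermitian fine fields
# (module D4-flat of the [15] Sect. B audit of seat `pub-ymgap-dag-n07-w1`; the junction S2 (47) ∕ S4 (157) flat files are written against)

Cell `pub-ymgap`, width seat `pub-ymgap-dag-n07-w1` generation 0 (DAG node N07 = [15] = [Balaban1985Variational]; item (α) of dag-n07-e's word l.26171, pointer (iii) FLAT;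
INTENT-5 l.26821).  NEW leaf, THEOREMS ONLY (0 `def`), `--kind proof --supports stmt-QuantumFields-20542` (K1⁷), count-neutral.  CONSUMED BY NAME, nothing modified: this
seat's `Node00.LinearisedAveragingAtBackground` (`dHolL`, `dAvgL`, `dIterL`, `dAvgL_apply`-shape lemma `hasFDerivAt_avgM_apply_of_eml`, `dIterL_succ_of`), 35b
`Node00.AveragingSmooth` (`stepM`, `holM`, `avgM`, `iterM`, `coe_holAt`), UST's `BlockAveragingEMLLinearised` (`walkSum`, ★ `linAvg` — [Balaban1985Averaging] (124)–(125) at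
the flat background), `BlockAveragingEMLLinearisedBackground` (`covWalkSum_walk_wordRev`, `covWalkSum_one`), `BlockAveragingEMLAnalyticMean` (`eml_one`, `hasFDerivAt_eml_one`:
`D eml(1) = mean`), `BlockAveraging` (the (0.4) words: `loopWord`, `walk_append`, `walkEnd_walkEnd_wordRev`, `wordRev_replicate`, `walkEnd_replicate_L`,
`BlockAveragingEMLProp2.walkEnd_stairWord_replicate`).

THE PRINT.  [Balaban1985Averaging] Prop. 3 (124)–(125) p. 36 (the linear form `L(Q(V₀)A)` at `V₀ = 1`: the tree's `linAvg`); [Balaban1985Variational] (44)–(47) p. 285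
(`Q_k(U₀)` and, at the flat background, the operators of Sect. C); [Balaban1987RG1] (0.4) p. 253, (0.21) p. 256.  PRECEDENT (Summits-side, not importable here, same
sentence in velocity currency): dag-n10-w1's `BalabanUVNodesN12FlatChartDerivIterLin.hasDerivAt_coe_iter_expChart_one_smul` (`d∕dt ↑Ū^k(1·exp(tX))(c)|₀ = (Q^{(k)}↑X)(c)` by the
quantitative route); THIS file identifies the OPERATOR `dIterL k 1` itself with the recursion, by differentiating 35b's closed forms (no estimate used).

CONTENTS (`M = M_N(ℂ)`; «skew» = `Y_b⋆ = −Y_b` at every bond, e.g. `𝔰𝔲(N)`-valued fields).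
* §1 the trivial field is a fixed point in the polydisc, NO guard needed: `stepM_one`, `holM_one`, `loopM_one`, `axialM_one`, `corrM_one`, `avgM_one`, `iterM_apply_one`,
  `loopM_one_mem_polydisc`, `hasFDerivAt_avgM_one`, `contDiffAt_iterM_one`, `hasFDerivAt_iterM_one`, ★ `dIterL_one_succ` (`Q_{k+1}(1) = dAvgL 1 ∘ Q_k(1)`).
* §2 the flat one-step derivative: `dHolL_one_apply` (`dHolL 1 γ Y = Σ_{s∈γ} stepM Y s`), `sum_map_stepM_of_skew` ∕ `dHolL_one_apply_of_skew` (on skew fields `= walkSum Y γ`),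
  ★ `dAvgL_one_apply` (`(dAvgL 1 Y)(c) = |I|⁻¹ Σ_i Σ_{s∈loop_i} stepM Y s + Σ_{s∈[c₋,c₊]} stepM Y s`), `star_walkSum_of_skew`, `star_linAvg_of_skew` (`linAvg` preserves skewness).
* §3 on `SU(N)` letters: `coeField_one`, `coe_holAt_one`, `walkSum_walk_wordRev` (`Y(−Γ) = −Y(Γ)`), ★ `walkSum_loopWalk` (the flat signed sum around a (0.4) loop
  `= Y(Γ^σ) + Y([x,x′]) − Y(Γ^{σ′}) − Y([y,y′])`), ★★ `dAvgL_one_apply_of_skew` — **`(dAvgL 1 Y)(c) = linAvg Y c` ON SKEW FIELDS** (one level), ★★★ `dIterL_one_apply_of_skew` —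
  **FOR EVERY RECURSION FAMILY `Q` (`Q 0 = id`, `Q (i+1) Y c = linAvg (Q i Y) c`, the currency of N12's flat files) AND EVERY SKEW `Y`: `dIterL k 1 Y = Q k Y`**, and `Q k Y` is skew;
  ★ `qLin_one_apply` (`qLin k 1 X c = dIterL k 1 ↑X c`), ★★★ `qLin_one_eq_family` — **`qLin k 1 X = Q k ↑X` for every Lie-algebra field `X`**.

HONEST FRAMING: real calculus∕bookkeeping about the tree's own averaging map at the flat background; NO estimate of [15]∕[7]; on non-skew matrix fields `dAvgL 1` carries
`Y_b⋆` (not `−Y_b`) on backward steps and is NOT `linAvg`; N07 NOT discharged; counts unmoved (5∕27); one finite 𝕋⁴ programme at fixed ε — NOT continuum ∕ ℝ⁴ ∕ OS ∕ mass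
gap ∕ Clay (R4 closes the conditional finite-𝕋⁴ rung `BalabanLadder.UV` only).  No `sorry`, no `def`, no `instance`, no `notation`.
-/

noncomputable section

namespace Literature.MathematicalPhysics.QuantumFieldTheory.Balaban1983to89.Node00

open Filter Topology
open T4Continuum BlockAveraging B15DeterminingSets
open ExpMeanLog (eml expMeanLogSU)
open T4AdjointCovarianceUnitary (lieSU)
open scoped Matrix.Norms.L2Operator

/-! ## §1–§2  The trivial field: fixed point, polydisc, flat chain rule; the flat one-step derivative -/

section Flat

variable {P : Params} {j : ℕ} {N : ℕ}

/-- The step matrices of the trivial field are `1` (`1⋆ = 1`). [cite: Balaban1987RG1, (0.4) p.253 (bookkeeping)] -/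
@[simp] theorem stepM_one (s : LStep P j) : stepM (1 : PBond P j → Matrix (Fin N) (Fin N) ℂ) s = 1 := by
  unfold stepM
  split_ifs <;> simp

/-- Walk products of the trivial field are `1`. [cite: Balaban1987RG1, (0.4) p.253 (bookkeeping)] -/
@[simp] theorem holM_one : ∀ γ : List (LStep P j), holM (1 : PBond P j → Matrix (Fin N) (Fin N) ℂ) γ = 1
  | [] => holM_nil _
  | s :: γ => by rw [holM_cons, stepM_one, holM_one γ, one_mul]

/-- The (0.4) loop matrices of the trivial field are `1`. [cite: Balaban1987RG1, (0.4) p.253 (bookkeeping)] -/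
@[simp] theorem loopM_one (c : PBond P (j + 1)) (i : Idx P) : loopM (1 : PBond P j → Matrix (Fin N) (Fin N) ℂ) c i = 1 := holM_one _

/-- The straight-segment matrix of the trivial field is `1`. [cite: Balaban1987RG1, (0.4) p.253 (bookkeeping)] -/
@[simp] theorem axialM_one (c : PBond P (j + 1)) : axialM (1 : PBond P j → Matrix (Fin N) (Fin N) ℂ) c = 1 := holM_one _

/-- The unguarded correction factor of the trivial field is `1` (`eml 1 = 1`). [cite: Balaban1987RG1, (0.4) p.253 (bookkeeping)] -/
@[simp] theorem corrM_one (c : PBond P (j + 1)) : corrM (1 : PBond P j → Matrix (Fin N) (Fin N) ℂ) c = 1 := by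
  unfold corrM
  simp only [loopM_one]
  exact BlockAveragingEMLAnalyticMean.eml_one

/-- ★ The trivial field is a fixed point of the matrix averaging: `avgM 1 = 1`. [cite: Balaban1987RG1, (0.4) p.253; Balaban1985Variational, (47) p.285 (flat background)] -/
@[simp] theorem avgM_one : avgM (1 : PBond P j → Matrix (Fin N) (Fin N) ℂ) = 1 := by
  funext c
  show corrM 1 c * axialM 1 c = 1
  rw [corrM_one, axialM_one, one_mul]

/-- … hence of every iterate: `iterM k 1 = 1`. [cite: Balaban1987RG1, (0.21) p.256 (bookkeeping)] -/
@[simp] theorem iterM_apply_one : ∀ k : ℕ, iterM k (1 : PBond P 0 → Matrix (Fin N) (Fin N) ℂ) = 1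
  | 0 => rfl
  | k + 1 => by rw [iterM_succ, iterM_apply_one k, avgM_one]

/-- The trivial field lies in the polydisc of every level (NO guard needed at the flat background). [cite: Balaban1987RG1, (0.4) p.253 (bookkeeping)] -/
theorem loopM_one_mem_polydisc (c : PBond P (j + 1)) (i : Idx P) : ‖loopM (1 : PBond P j → Matrix (Fin N) (Fin N) ℂ) c i - 1‖ < 1 := by
  rw [loopM_one, sub_self, norm_zero]
  exact one_pos

/-- `avgM` has derivative `dAvgL 1` at the trivial field. [cite: Balaban1985Averaging, Prop. 3 (121)-(124) p.36] -/
theorem hasFDerivAt_avgM_one :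
    HasFDerivAt (avgM : (PBond P j → Matrix (Fin N) (Fin N) ℂ) → PBond P (j + 1) → Matrix (Fin N) (Fin N) ℂ) (dAvgL 1) 1 :=
  hasFDerivAt_avgM loopM_one_mem_polydisc

/-- `iterM k` is `C^∞` at the trivial field (induction through the fixed point). [cite: Balaban1987RG1, (0.21) p.256, p.253 («analytic function»)] -/
theorem contDiffAt_iterM_one : ∀ k : ℕ, ContDiffAt ℝ ⊤ (iterM k : (PBond P 0 → Matrix (Fin N) (Fin N) ℂ) → PBond P k → Matrix (Fin N) (Fin N) ℂ) 1
  | 0 => contDiffAt_id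
  | k + 1 => by
    have hk : ContDiffAt ℝ ⊤ (avgM : (PBond P k → Matrix (Fin N) (Fin N) ℂ) → PBond P (k + 1) → Matrix (Fin N) (Fin N) ℂ)
        (iterM k (1 : PBond P 0 → Matrix (Fin N) (Fin N) ℂ)) := by
      rw [iterM_apply_one]
      exact contDiffAt_avgM loopM_one_mem_polydisc
    exact hk.comp (1 : PBond P 0 → Matrix (Fin N) (Fin N) ℂ) (contDiffAt_iterM_one k)

/-- `iterM k` has derivative `Q_k(1) = dIterL k 1` at the trivial field. [cite: Balaban1985Variational, (44),(47) p.285] -/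
theorem hasFDerivAt_iterM_one (k : ℕ) :
    HasFDerivAt (iterM k : (PBond P 0 → Matrix (Fin N) (Fin N) ℂ) → PBond P k → Matrix (Fin N) (Fin N) ℂ) (dIterL k 1) 1 :=
  ((contDiffAt_iterM_one k).differentiableAt (by simp)).hasFDerivAt

/-- ★ **THE FLAT CHAIN RULE** (no guard): `Q_{k+1}(1) = dAvgL 1 ∘ Q_k(1)`. [cite: Balaban1985Variational, (44),(47) p.285; Balaban1987RG1, (0.21) p.256] -/
theorem dIterL_one_succ (k : ℕ) :
    dIterL (k + 1) (1 : PBond P 0 → Matrix (Fin N) (Fin N) ℂ) = (dAvgL (1 : PBond P k → Matrix (Fin N) (Fin N) ℂ)).comp (dIterL k 1) := by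
  have h := dIterL_succ_of ((contDiffAt_iterM_one (P := P) (N := N) k).differentiableAt (by simp))
    (by rw [iterM_apply_one]; exact loopM_one_mem_polydisc)
  rw [iterM_apply_one] at h
  exact h

/-- **The flat derivative of a walk product is the step sum**: `dHolL 1 γ Y = Σ_{s∈γ} stepM Y s` (`Y_b` forward, `Y_b⋆` backward). [cite: Balaban1985Averaging, (58) p.27, (124) p.36] -/
theorem dHolL_one_apply (Y : PBond P j → Matrix (Fin N) (Fin N) ℂ) :
    ∀ γ : List (LStep P j), dHolL (1 : PBond P j → Matrix (Fin N) (Fin N) ℂ) γ Y = (γ.map (stepM Y)).sum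
  | [] => by simp
  | s :: γ => by
    rw [dHolL_cons_apply, dHolL_one_apply Y γ, stepM_one, holM_one, one_mul, mul_one, List.map_cons, List.sum_cons, add_comm]

/-- On SKEW fields (`Y_b⋆ = −Y_b`) the step sum is UST's signed sum `walkSum Y γ` (`+Y_b` forward, `−Y_b` backward). [cite: Balaban1984PropagatorsI, (1.8) p.19; Balaban1985Averaging, (124) p.36] -/
theorem sum_map_stepM_of_skew {Y : PBond P j → Matrix (Fin N) (Fin N) ℂ} (hY : ∀ b, star (Y b) = -Y b) :
    ∀ γ : List (LStep P j), (γ.map (stepM Y)).sum = BlockAveragingEMLLinearised.walkSum Y γ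
  | [] => by simp
  | s :: γ => by
    rw [List.map_cons, List.sum_cons, BlockAveragingEMLLinearised.walkSum_cons, sum_map_stepM_of_skew hY γ]
    unfold stepM
    by_cases h : s.fwd
    · simp only [h, if_true]
    · simp only [h, Bool.false_eq_true, ↓reduceIte, hY]

/-- `dHolL 1 γ Y = walkSum Y γ` on skew fields. [cite: Balaban1985Averaging, (58) p.27, (124) p.36] -/
theorem dHolL_one_apply_of_skew {Y : PBond P j → Matrix (Fin N) (Fin N) ℂ} (hY : ∀ b, star (Y b) = -Y b) (γ : List (LStep P j)) :
    dHolL (1 : PBond P j → Matrix (Fin N) (Fin N) ℂ) γ Y = BlockAveragingEMLLinearised.walkSum Y γ := by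
  rw [dHolL_one_apply, sum_map_stepM_of_skew hY]

/-- ★ **THE FLAT ONE-STEP FORMULA**: `(dAvgL 1 Y)(c) = |I|⁻¹ Σ_i Σ_{s∈loop_i} stepM Y s + Σ_{s∈[c₋,c₊]} stepM Y s` (`D eml(1)` = the arithmetic mean,
`BlockAveragingEMLAnalyticMean.hasFDerivAt_eml_one`; `corrM 1 = axialM 1 = 1`). [cite: Balaban1985Averaging, (124) p.36; Balaban1987RG1, (0.4) p.253] -/
theorem dAvgL_one_apply (Y : PBond P j → Matrix (Fin N) (Fin N) ℂ) (c : PBond P (j + 1)) :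
    dAvgL (1 : PBond P j → Matrix (Fin N) (Fin N) ℂ) Y c =
      ((Fintype.card (Idx P) : ℂ))⁻¹ • ∑ i : Idx P, (((walk (emb c.src) (loopWord P.L c.dir (off i.1) i.2.1 i.2.2))).map (stepM Y)).sum +
        ((walk (emb c.src) (List.replicate P.L (c.dir, true))).map (stepM Y)).sum := by
  have h1 : HasFDerivAt (fun V : PBond P j → Matrix (Fin N) (Fin N) ℂ => avgM V c)
      ((ContinuousLinearMap.proj (R := ℝ) (φ := fun _ : PBond P (j + 1) => Matrix (Fin N) (Fin N) ℂ) c).comp (dAvgL 1)) 1 :=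
    (hasFDerivAt_pi'.1 (hasFDerivAt_avgM_one (P := P) (j := j) (N := N))) c
  have hE : HasFDerivAt (eml : (Idx P → Matrix (Fin N) (Fin N) ℂ) → Matrix (Fin N) (Fin N) ℂ)
      ((B7TransferAnalyticMean.meanCLM (Idx P) (Matrix (Fin N) (Fin N) ℂ)).restrictScalars ℝ)
      (fun i => loopM (1 : PBond P j → Matrix (Fin N) (Fin N) ℂ) c i) := by
    have h11 : (fun i => loopM (1 : PBond P j → Matrix (Fin N) (Fin N) ℂ) c i) = 1 := funext fun i => loopM_one c i
    rw [h11]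
    exact (BlockAveragingEMLAnalyticMean.hasFDerivAt_eml_one).restrictScalars ℝ
  have h2 := hasFDerivAt_avgM_apply_of_eml c hE
  have h12 := h1.unique h2
  have happ := congrArg (fun L : (PBond P j → Matrix (Fin N) (Fin N) ℂ) →L[ℝ] Matrix (Fin N) (Fin N) ℂ => L Y) h12
  simp only [ContinuousLinearMap.comp_apply, ContinuousLinearMap.proj_apply, add_apply, smul_apply, ContinuousLinearMap.smulRight_apply,
    ContinuousLinearMap.coe_restrictScalars', smul_eq_mul, corrM_one, axialM_one, one_mul, mul_one, B7TransferAnalyticMean.meanCLM_apply,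
    ContinuousLinearMap.pi_apply, dHolL_one_apply] at happ
  rw [happ, add_comm]

/-- The signed sum of a skew field is skew. [cite: Balaban1984PropagatorsI, (1.8) p.19 (bookkeeping)] -/
theorem star_walkSum_of_skew {Y : PBond P j → Matrix (Fin N) (Fin N) ℂ} (hY : ∀ b, star (Y b) = -Y b) :
    ∀ γ : List (LStep P j), star (BlockAveragingEMLLinearised.walkSum Y γ) = -BlockAveragingEMLLinearised.walkSum Y γ
  | [] => by simp
  | s :: γ => by
    rw [BlockAveragingEMLLinearised.walkSum_cons, star_add, star_walkSum_of_skew hY γ, neg_add]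
    split_ifs <;> simp [hY]

/-- ★ `linAvg` maps skew fields to skew values (real mean of skew signed sums). [cite: Balaban1985Averaging, (124)-(125) p.36 (bookkeeping)] -/
theorem star_linAvg_of_skew {Y : PBond P j → Matrix (Fin N) (Fin N) ℂ} (hY : ∀ b, star (Y b) = -Y b) (c : PBond P (j + 1)) :
    star (BlockAveragingEMLLinearised.linAvg Y c) = -BlockAveragingEMLLinearised.linAvg Y c := by
  rw [BlockAveragingEMLLinearised.linAvg_def, star_smul, star_sum, star_inv₀, star_natCast, ← smul_neg, ← Finset.sum_neg_distrib]
  congr 1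
  refine Finset.sum_congr rfl fun i _ => ?_
  rw [star_sub, star_add, star_walkSum_of_skew hY, star_walkSum_of_skew hY, star_walkSum_of_skew hY]
  abel

end Flat

/-! ## §3  On `SU(N)` letters: reversed walks, the loop split, THE JUNCTIONS -/

section FlatSU

variable {P : Params} {j : ℕ} {N : ℕ} [NeZero N]

/-- The matrix field of the trivial `SU(N)` configuration is the trivial matrix field. [cite: Balaban1987RG1, (0.1) p.251 (bookkeeping)] -/
theorem coeField_one : coeField (1 : GaugeField P j (SU N)) = 1 := rfl

/-- Holonomies of the trivial configuration are `1` (as matrices). [cite: Balaban1987RG1, (0.4) p.253 (bookkeeping)] -/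
theorem coe_holAt_one (γ : List (LStep P j)) : ((holAt (1 : GaugeField P j (SU N)) γ : SU N) : Matrix (Fin N) (Fin N) ℂ) = 1 := by
  rw [coe_holAt, coeField_one, holM_one]

/-- **REVERSED WALKS FLIP THE SIGN**: `Y(−Γ) = −Y(Γ)` for UST's signed sum (the flat case of `BlockAveragingEMLLinearisedBackground.covWalkSum_walk_wordRev`). [cite: Balaban1984PropagatorsI, (1.8) p.19; Balaban1985Averaging, (58) p.27] -/
theorem walkSum_walk_wordRev (Y : PBond P j → Matrix (Fin N) (Fin N) ℂ) (x : Site P j) (w : List (Letter P.d)) :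
    BlockAveragingEMLLinearised.walkSum Y (walk (walkEnd x w) (wordRev w)) = -BlockAveragingEMLLinearised.walkSum Y (walk x w) := by
  haveI : Nonempty (Fin N) := ⟨⟨0, Nat.pos_of_ne_zero (NeZero.ne N)⟩⟩
  have h := BlockAveragingEMLLinearisedBackground.covWalkSum_walk_wordRev (1 : GaugeField P j (SU N)) Y x w
  rw [BlockAveragingEMLLinearisedBackground.covWalkSum_one, BlockAveragingEMLLinearisedBackground.covWalkSum_one, coe_holAt_one, star_one,
    one_mul, mul_one] at h
  exact h

/-- ★ **THE FLAT SIGNED SUM AROUND A (0.4) LOOP** `Γ^σ_{y→x} ∪ [x,x′] ∪ (−Γ^{σ′}_{y′→x′}) ∪ (−[y,y′])`: `Y(loop_i) = Y(Γ^σ) + Y([x,x′]) − Y(Γ^{σ′}) − Y([y,y′])`.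
[cite: Balaban1985Averaging, (124) p.36; Balaban1987RG1, (0.4) p.253] -/
theorem walkSum_loopWalk (Y : PBond P j → Matrix (Fin N) (Fin N) ℂ) (c : PBond P (j + 1)) (i : Idx P) :
    BlockAveragingEMLLinearised.walkSum Y (walk (emb c.src) (loopWord P.L c.dir (off i.1) i.2.1 i.2.2)) =
      BlockAveragingEMLLinearised.walkSum Y (walk (emb c.src) (stairWord i.2.1 (off i.1))) +
        BlockAveragingEMLLinearised.walkSum Y (walk (walkEnd (emb c.src) (stairWord i.2.1 (off i.1))) (List.replicate P.L (c.dir, true))) -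
        BlockAveragingEMLLinearised.walkSum Y (walk (emb c.tgt) (stairWord i.2.2 (off i.1))) -
        BlockAveragingEMLLinearised.walkSum Y (walk (emb c.src) (List.replicate P.L (c.dir, true))) := by
  unfold loopWord
  rw [walk_append, BlockAveragingEMLLinearised.walkSum_append, walk_append, BlockAveragingEMLLinearised.walkSum_append, walk_append,
    BlockAveragingEMLLinearised.walkSum_append, BlockAveragingEMLProp2.walkEnd_stairWord_replicate c.src c.dir i.2.1 i.2.2 (off i.1),
    show c.src.shift c.dir = c.tgt from rfl, walkSum_walk_wordRev, walkEnd_walkEnd_wordRev]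
  have h4 : List.replicate P.L (c.dir, false) = wordRev (List.replicate P.L (c.dir, true)) := by rw [wordRev_replicate]; rfl
  rw [h4, show emb c.tgt = walkEnd (emb c.src) (List.replicate P.L (c.dir, true)) from (walkEnd_replicate_L c.src c.dir).symm,
    walkSum_walk_wordRev, walkEnd_replicate_L]
  abel

/-- ★★ **ONE LEVEL AT THE FLAT BACKGROUND: `(dAvgL 1 Y)(c) = linAvg Y c` ON SKEW FIELDS** — the derivative of 35b's matrix averaging at `1` IS UST's linearised (0.4)
average `Q₁` of [Balaban1985Averaging] (124)–(125) (the `−[y,y′]` segments of the loops cancel the straight-segment term in the mean). [cite: Balaban1985Averaging, Prop. 3 (124)-(125) p.36; Balaban1985Variational, (47) p.285] -/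
theorem dAvgL_one_apply_of_skew {Y : PBond P j → Matrix (Fin N) (Fin N) ℂ} (hY : ∀ b, star (Y b) = -Y b) (c : PBond P (j + 1)) :
    dAvgL (1 : PBond P j → Matrix (Fin N) (Fin N) ℂ) Y c = BlockAveragingEMLLinearised.linAvg Y c := by
  have hc : (Fintype.card (Idx P) : ℂ) ≠ 0 := Nat.cast_ne_zero.mpr Fintype.card_pos.ne'
  rw [dAvgL_one_apply, BlockAveragingEMLLinearised.linAvg_def]
  simp only [sum_map_stepM_of_skew hY, walkSum_loopWalk]
  rw [Finset.sum_sub_distrib, Finset.sum_const, Finset.card_univ, smul_sub, ← Nat.cast_smul_eq_nsmul ℂ, smul_smul, inv_mul_cancel₀ hc, one_smul,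
    sub_add_cancel]

/-- ★★★ **`Q_k(1)` IS THE `linAvg` RECURSION ON SKEW FIELDS.**  For every recursion family `Q` (`Q 0 Y = Y`, `Q (i+1) Y c = linAvg (Q i Y) c` — the DISPLAYED currency of
the N12 flat files) and every skew fine field `Y`: `dIterL k 1 Y = Q k Y`, and `Q k Y` is skew (induction: the flat chain rule `dIterL_one_succ`, the one-level junction at the
skew field `Q k Y`, and `star_linAvg_of_skew`). [cite: Balaban1985Variational, (44)-(47) p.285; Balaban1985Averaging, Prop. 3 (124)-(125) p.36; Balaban1987RG1, (0.21) p.256] -/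
theorem dIterL_one_apply_of_skew
    (Q : (i : ℕ) → (PBond P 0 → Matrix (Fin N) (Fin N) ℂ) → PBond P i → Matrix (Fin N) (Fin N) ℂ)
    (hQ0 : ∀ Y, Q 0 Y = Y)
    (hQs : ∀ (i : ℕ) (Y : PBond P 0 → Matrix (Fin N) (Fin N) ℂ) (c : PBond P (i + 1)), Q (i + 1) Y c = BlockAveragingEMLLinearised.linAvg (Q i Y) c)
    {Y : PBond P 0 → Matrix (Fin N) (Fin N) ℂ} (hY : ∀ b, star (Y b) = -Y b) :
    ∀ k : ℕ, dIterL k (1 : PBond P 0 → Matrix (Fin N) (Fin N) ℂ) Y = Q k Y ∧ ∀ c : PBond P k, star (Q k Y c) = -Q k Y c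
  | 0 => ⟨by rw [dIterL_zero, ContinuousLinearMap.id_apply, hQ0], fun c => by rw [hQ0]; exact hY c⟩
  | k + 1 => by
    obtain ⟨ih, ihY⟩ := dIterL_one_apply_of_skew Q hQ0 hQs hY k
    refine ⟨?_, fun c => by rw [hQs]; exact star_linAvg_of_skew ihY c⟩
    funext c
    rw [dIterL_one_succ, ContinuousLinearMap.comp_apply, ih, dAvgL_one_apply_of_skew ihY, hQs]

/-- ★ **AT THE FLAT BACKGROUND THE LEFT-TRIVIALISED READING IS THE MATRIX OPERATOR ITSELF**: `(qLin k 1 X)(c) = (dIterL k 1 ↑X)(c)` (`Ū^k(1) = 1`, `1⋆ = 1`, `1·X_b = X_b`).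
[cite: Balaban1985Variational, (44),(47) p.285] -/
theorem qLin_one_apply (k : ℕ) (X : PBond P 0 → lieSU (Fin N)) (c : PBond P k) :
    qLin k (1 : GaugeField P 0 (SU N)) X c = dIterL k (1 : PBond P 0 → Matrix (Fin N) (Fin N) ℂ) (fun b => (X b : Matrix (Fin N) (Fin N) ℂ)) c := by
  have hv : (fun b => (((1 : GaugeField P 0 (SU N)) b : SU N) : Matrix (Fin N) (Fin N) ℂ) * (X b : Matrix (Fin N) (Fin N) ℂ)) =
      fun b => (X b : Matrix (Fin N) (Fin N) ℂ) := by
    funext b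
    exact one_mul _
  rw [qLin_apply, coeField_one, iterM_apply_one, hv, Pi.one_apply, star_one, one_mul]

/-- ★★★ **`Q_k(1)X` ON LIE-ALGEBRA FIELDS IS THE `linAvg` RECURSION** (the form S2 (47) ∕ S4 (157) consumers quote): for every recursion family `Q` as above and every
`X : bonds → 𝔰𝔲(N)`, `qLin k 1 X = Q k ↑X`. [cite: Balaban1985Variational, (44)-(47) p.285; Balaban1985Averaging, Prop. 3 (124)-(125) p.36] -/
theorem qLin_one_eq_family
    (Q : (i : ℕ) → (PBond P 0 → Matrix (Fin N) (Fin N) ℂ) → PBond P i → Matrix (Fin N) (Fin N) ℂ)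
    (hQ0 : ∀ Y, Q 0 Y = Y)
    (hQs : ∀ (i : ℕ) (Y : PBond P 0 → Matrix (Fin N) (Fin N) ℂ) (c : PBond P (i + 1)), Q (i + 1) Y c = BlockAveragingEMLLinearised.linAvg (Q i Y) c)
    (k : ℕ) (X : PBond P 0 → lieSU (Fin N)) :
    qLin k (1 : GaugeField P 0 (SU N)) X = Q k (fun b => (X b : Matrix (Fin N) (Fin N) ℂ)) := by
  have hX : ∀ b, star ((X b : lieSU (Fin N)) : Matrix (Fin N) (Fin N) ℂ) = -((X b : lieSU (Fin N)) : Matrix (Fin N) (Fin N) ℂ) :=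
    fun b => (T4AdjointCovarianceUnitary.mem_lieSU_iff.1 (X b).2).1
  funext c
  rw [qLin_one_apply, (dIterL_one_apply_of_skew Q hQ0 hQs hX k).1]

end FlatSU

end Literature.MathematicalPhysics.QuantumFieldTheory.Balaban1983to89.Node00

end
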